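import Summits.ABC.ABC.Theses.DefiniteXi
import Literature.NumberTheory.EllipticCurves.NewformPeterssonSize
import Literature.NumberTheory.EllipticCurves.HeckeOperatorsEigenvalueBoundProofs
import HarnessLib

/-!
# Disproof of `PeterssonLowerBound` (crux stmt-ABC-10870, route DefiniteXi) — findings

Crux (verbatim the named fact `murty_petersson_newform_lower_bound`, `crux_iff_fact`):
`∀ ε > 0, ∃ c > 0, ∀ N ≥ 1, ∀ W/ℚ elliptic, ∀ f ∈ S₂(Γ₀(N)), IsNewformOf W f → c·N^{1-ε} ≤ Re (f,f)_{Γ₀(N)}`.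

## Verdict of cycle 1: NO KILL — the statement is a theorem in print and is typed faithfully.

* In print: `(f,f) ≍ N · L^{(N)}(Sym² f, 1)` up to absolute constants and factors `∏_{p²∣N}(1-p⁻²)`
  (Rankin 1939; the tree's own `IsNewform0.tendsto_tprod_symmSq`:
  `lim_{w→2⁺} ∏_{p∤N} L_p^{naive}(w) = (8π³/N) ∏_{p∥N}(1-p⁻²) Re(f,f)`), and
  `L(1, Sym² f) ≫ 1/log N` for non-CM `f` (Hoffstein–Lockhart 1994 + Goldfeld–Hoffstein–Lieman),
  while for CM elliptic curves over `ℚ` the CM field is one of 9 fixed fields, so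
  `L(1, Sym² f) = L(1, χ_K) L(1, ψ²) ≫ 1/log N` effectively (`L(1,χ_K)` takes 9 values; `L(s,ψ²)` is
  the `L`-function of a CM cusp form of weight 3, no Siegel zero by Hoffstein–Ramakrishnan 1995).
  Hence `(f,f) ≫ N/((log N)(log log N)³)` effectively for every `E/ℚ` — stronger than the crux.
* ROBUSTNESS: the crux does not even depend on the tree's Hecke/new-subspace layer being right.
  If `newSubspace0`/`heckeT` were junk (too large / zero), `IsNewformOf W f` would still pin the
  `q`-expansion of `f` to `∑ aₙ(E) qⁿ` (`eq_of_forall_cuspCoeff_eq`, proved from Mathlib), i.e.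
  `f = f_E` viewed at a level `N` with `N_E ∣ N`, and then
  `(f,f)_N = [Γ₀(N_E):Γ₀(N)] (f,f)_{N_E} ≥ (N/N_E)·c N_E^{1-ε} ≥ c N^{1-ε}` because the product is
  UN-normalised (the coset sum in `peterssonProduct` multiplies by the index exactly). So only
  `peterssonProduct`, `cuspCoeff` and `WeierstrassCurve.LFunction` matter, and those are genuine.
* Definitions audited for junk (all faithful, so no formal loophole):
  - `peterssonProduct` = Bochner integral over `ModularGroup.fd` of the coset sum of
    `conj f · f · y²` w.r.t. Mathlib's `volume` on `ℍ` = `dx dy / y²` (Mathlib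
    `UpperHalfPlane.volume_def`); covers `Γ₀(N)\ℍ` exactly once (`-1 ∈ Γ₀(N)`), no `1/vol`.
    UN-normalised, so the claimed order `N^{1-ε}` is the right one (a vol-normalised product would
    make the crux false).
  - `IsNewformOf W f = IsNewform0 f ∧ ∀ n, aₙ(f) = W.LFunction n`; `IsNewform0` contains
    `IsNormalized f` (`a₁ = 1`), so `f = 0` and the scaling family `λ • f` are excluded.
  - `WeierstrassCurve.LFunction` (Mathlib 2026) = Euler product over primes of the local factors of a
    MINIMAL model at `p` (`W.minimal`, `Nat.card` of points of the reduction incl. `O`), i.e. the true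
    `aₙ(E)` of the curve `E` defined by `W`, model-independent; `eulerProduct` is a `tprod` whose
    multipliability holds (Northcott in the norm), value at `1` is `1`.
  So `IsNewformOf W f` holds iff `f` is THE newform of `E/ℚ` (and then `N = N_E`, Carayol), and the
  crux is exactly Hoffstein–Lockhart–GHL for rational newforms.

## (a) Load-bearing analysis (Lean) — LANDED as `Summits/ABC/ABC/Theorems/PeterssonLowerBound/Negative/LoadBearing.lean`
(p99037, accepted 2026-08-16; namespace `Summit.ABC.ABC.Theorems.PeterssonLowerBound.Negative`:
`peterssonLowerBound_false_without_normalisation`, `isNormalized_of_forall_cuspCoeff_eq`,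
`isNewformOf_iff_new_eigen_coeff`, `peterssonLowerBound_nonnegConst_trivial`,
`peterssonLowerBound_uniform_iff_exponentOne`; importable by ideators/planners/the lead)
* `peterssonLowerBound_false_without_normalisation`: drop `a₁ = 1` (equivalently the coefficient
  identity, which implies it since `W.LFunction 1 = 1`) but KEEP "new" and "Hecke-eigen": FALSE,
  witness `f = 0 ∈ S₂(Γ₀(1))`. Any proof must use the normalisation.
* NOT load-bearing (paper, cannot be turned into `¬`): "new" (an oldform from level `M ∣ N` has
  `(f,f)_N = [Γ₀(M):Γ₀(N)] (f,f)_M ≫ (N/M) M^{1-ε}` — the un-normalised product absorbs the index);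
  "attached to an elliptic curve" (HL94 holds for every newform, CM/dihedral ones via Siegel,
  ineffectively); `W.IsElliptic` (for singular `W` no newform matches `aₙ(W)`, vacuous).
* `peterssonLowerBound_nonnegConst_trivial`: with `0 ≤ c` in place of `0 < c` the statement is
  trivially true (`c = 0`, `Re(f,f) ≥ 0`): all content sits in the positivity of `c`.

## (b) Tightness / (c) natural strengthenings
* `PeterssonLowerBoundExponentOne` (`∃ c > 0, c·N ≤ Re(f,f)` for all elliptic newforms): FALSE on
  paper (`not_peterssonLowerBoundExponentOne`, sorried here, full argument in its docstring:
  quadratic twists of a fixed curve by products of primes with `a_p² ≥ 2p+1` lose a factor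
  `∏_{p∣d}(1-1/p) → 0`). So the `ε`-loss in the crux cannot be removed; the true extremal order lies
  between `N/(log N)^{1+o(1)}` and `N/(log log N)^{δ}`, `δ = 1/2 - 1/π`.
* `PeterssonLowerBoundUniform` (`∃ c > 0, ∀ ε > 0, …`, quantifiers swapped): implies
  `…ExponentOne` (`peterssonLowerBoundUniform_imp_exponentOne`, proved: let `ε → 0⁺`), hence FALSE
  on paper as well.

## (d) Targets / line `Sketch` (lead prover-line-stmt-ABC-10870-0)
No stuck stubs were handed over (payload.targets = []). Audit of the five stubs of
`Cruxes/PeterssonLowerBound/Lines/Sketch.lean` (all TRUE in print; none refutable; notes for the lead):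
* `stub_localGHL` (pure analysis): true, and provable from the tree's Lemma α
  (`titchmarsh_logDeriv_sub_sum_of_differentiableOn`) WITHOUT any multiplicity bookkeeping — this is
  what dividing out `(s-β)^{m+1}` buys. Route checked on paper: put `R = ρ/8`; if
  `1-β ≥ R/(2(m+1))` the claim is trivial with `c ≤ R/(2(m+1))` (`B ≥ 1`); else set
  `δ = (2m+1)(1-β)`, `σ₀ = 1+δ` (so `σ₀-β = (2m+2)(1-β) < R`, `δ < R`). Lemma α for `G` at centre
  `σ₀`, radius `R`, `R₀ = ρ/2 > 3R` (`ball σ₀ R₀ ⊆ ball 1 ρ`). Bound `M` on `closedBall σ₀ (2R)`: by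
  the MAXIMUM MODULUS principle (`Complex.norm_le_of_forall_mem_frontier_norm_le`) from the sphere
  `|s-σ₀| = 2R`, where `|s-β| ≥ 2R-(σ₀-β) > R`, so `‖G‖ ≤ M := e^B/R^{m+1}`. Lower bound at the
  centre: `‖G σ₀‖ = δ^m‖Z σ₀‖/(σ₀-β)^{m+1} ≥ δ^m/(σ₀-β)^{m+1}`, whence
  `log(M/‖G σ₀‖) ≤ B + (m+1)log(1/R) + log((2m+2)^{m+1}(1-β)/(2m+1)^m) ≤ B + C(m,ρ)` (the last log
  is negative for `1-β` small). All zeros `a ∈ S` of `G` satisfy `Re a ≤ 1 < σ₀`, so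
  `Re(m(a)/(σ₀-a)) ≥ 0` and the whole zero sum is DROPPED: `-Re G'/G(σ₀) ≤ 8(B+C+1)/R`. With
  `G'/G(σ₀) = Z'/Z(σ₀) + m/δ - (m+1)/(σ₀-β)` and `Re Z'/Z(σ₀) ≤ 0`:
  `1/(2(2m+1)(1-β)) = (m+1)/(σ₀-β) - m/δ ≤ 8(B+C+1)/R ≤ 8(C+2)B/R`, i.e. `β ≤ 1 - c/B` with
  `c = R/(16(2m+1)(C+2))`. Degenerate cases (`β ≤ 1-ρ`, `m = 0`) consistent; no counterexample
  among `G = K e^{-λ s}`-type extremisers (they force `B ≳ λρ`, matching the conclusion).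
* `stub_symmSqL_logEuler`: consistent with the tree's normalisation
  `symmSqL = ζ(2s) L(|a|², s+1)/ζ(s)` (`symmSqL_eq_of_one_lt_re`): indeed
  `ζ(2s)D(s)/ζ(s) = ∏_{p∣N}(1+p^{-s})^{-1} ∏_{p∤N} L_p(Sym², s) ∏_{p∥N}(1-p^{-1-s})^{-1}`, matching the
  three coefficient cases `(P_k²-1)/k`, `p^{-k}/k`, `0` and the correction `∏_{p∣N}(1+p^{-s})`.
  The Ramanujan hypothesis `hR` is genuinely needed (absolute convergence on all of `Re s > 1`).
* `stub_ZE`: true (GHL's `Z = ζ² L³ L₄`, log-coefficients `P_k⁴ ≥ 0` at good `p`, `≥ 0` at bad `p`);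
  silently uses two TREE inputs not among its hypotheses: holomorphy of `symmSqL` on the Siegel
  ball (`differentiableOn_symmSqL_ball`) and the polynomial bound (`exists_norm_symmSqL_le`); note
  the `e^B` bound is on `(s-β)³G = ζ₁²(L_f·corr)³L₄` itself, so NO bound on the `dslope` is needed
  (`|corr| ≤ 2^{ω(N)} ≤ N+1`). Zeros of `G` right of `Re s = 1`: none, since
  `L_f = ζ(2s)L(|a|²,s+1)/ζ(s)` is an absolutely convergent Euler product of non-zero factors there.
  For CM `f` the `L₄`-hypothesis is unsatisfiable (Sym⁴ has a pole) — harmless.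
* `stub_fact_symmFour` (the one named-fact debt): TRUE in print, but typed STRONGER than used —
  the bound `‖L₄ s‖ ≤ C N^K` is demanded on `closedBall 2 (3/2)` (down to `Re s = 1/2`) while the
  glue only evaluates it on `ball 1 r ⊆ closedBall 2 (1 + r)`, `r ≤ 1/4` (`Re s ≥ 3/4`). A cheaper
  fact (same shape on `closedBall 2 (5/4)`, or on `ball 2 (1 + 2r)` for the Siegel radius) would
  serve verbatim; both are convexity bounds for the entire `L(s, Sym⁴ E)` (Kim 2003 Thm B,
  Kim–Shahidi 2002 cuspidality for non-CM `E/ℚ`), analytic conductor `≤ N^{O(1)}`, and the PARTIAL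
  product over `p ∤ N` differs from it by finitely many polynomial factors `∏_{p∣N} L_p(s)⁻¹` of
  modulus `≤ 2^5` each on `Re s ≥ 1/2`, i.e. `≤ (N+1)^5` in total.
* `stub_ramanujan` / `ramanujan_of_isNewformOf`: true for ALL `p` (bad `p`: `|a_p| ≤ 1`), so the
  unproved level = conductor fact (Carayol) is not needed.
* `stub_j0`: true and EFFECTIVE (`L(1,Sym² f) = L(1,χ₋₃) L(1,ψ²)`, `ψ²` of infinite order: no
  exceptional zero).
* Joint sufficiency: `PeterssonLowerBound_of` is machine-checked in the skeleton; the only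
  external inputs are Hasse (now a tree theorem) and the `Sym⁴` package `hSym4` (Kim 2003 Thm B +
  Kim–Shahidi 2002 cuspidality for non-CM + convexity on `|s-2| ≤ 3/2`; the PARTIAL Euler product
  `L^{(N)}(Sym⁴ f, s)` is entire since removed local factors are polynomials in `p^{-s}`; the bound
  `C N^K` holds with absolute `K` because the conductor of `Sym⁴ E` divides a fixed power of `N`).
  TRUE in print; it is the honest residual debt of the line.
-/

noncomputable section

open scoped Real Topology
open Filter CongruenceSubgroup
open Literature.NumberTheory.EllipticCurves.ModularForms

namespace Summit.ABC.ABC.Cruxes.PeterssonLowerBound.Disproof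

/-! ### The crux is the named fact, verbatim -/

/-- The route decl is definitionally the Literature named fact
`murty_petersson_newform_lower_bound` (so a disproof would refute Hoffstein–Lockhart 1994 for
rational newforms). [cite: HoffsteinLockhart1994, Thm. 0.1] -/
theorem crux_iff_fact :
    Summit.ABC.ABC.Theses.DefiniteXi.PeterssonLowerBound ↔ murty_petersson_newform_lower_bound :=
  Iff.rfl

/-! ### (a) Load-bearing analysis -/

/-- The crux with the normalisation `a₁ = 1` (and the coefficient identity `aₙ(f) = aₙ(W)`, which
implies it) DROPPED, keeping "`f` is new" and "`f` is a Hecke eigenform for every `T_p`". [folklore] -/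
def PeterssonLowerBoundWithoutNormalisation : Prop :=
  ∀ ε : ℝ, 0 < ε → ∃ c : ℝ, 0 < c ∧
    ∀ (N : ℕ) [NeZero N] (f : CuspForm (Gamma0 N) 2),
      f ∈ newSubspace0 N 2 → IsHeckeEigenform f →
        c * (N : ℝ) ^ (1 - ε) ≤ (peterssonProduct (Gamma0 N) 2 f f).re

/-- **Any proof must use `a₁ = 1`.** Without the normalisation the statement fails at
`f = 0 ∈ S₂(Γ₀(1))`, which lies in the (kernel-defined) new subspace and is an eigenvector of
every `T_p`, while `(0,0) = 0 < c`. (The same witness kills every variant keeping any subset of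
{new, eigen, level = conductor}; with a nonzero form `g` the family `λ • g`, `λ → 0`, would do the
same, but no nonzero cusp form is constructible in the tree today.) [folklore] -/
theorem peterssonLowerBound_false_without_normalisation :
    ¬ PeterssonLowerBoundWithoutNormalisation := by
  intro h
  obtain ⟨c, hc, h1⟩ := h 1 one_pos
  have key := h1 1 (0 : CuspForm (Gamma0 1) 2) (Submodule.zero_mem _)
    (fun p hp ↦ ⟨0, by simp⟩)
  rw [peterssonProduct_zero_left] at key
  norm_num at key
  linarith

/-- The crux with `0 < c` weakened to `0 ≤ c`. [folklore] -/
def PeterssonLowerBoundNonnegConst : Prop :=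
  ∀ ε : ℝ, 0 < ε → ∃ c : ℝ, 0 ≤ c ∧
    ∀ (N : ℕ) [NeZero N] (W : WeierstrassCurve ℚ) [W.IsElliptic] (f : CuspForm (Gamma0 N) 2),
      IsNewformOf W f → c * (N : ℝ) ^ (1 - ε) ≤ (peterssonProduct (Gamma0 N) 2 f f).re

/-- **All content is in `0 < c`**: with `0 ≤ c` the statement is trivial (`c = 0`,
`Re (f,f) ≥ 0` is the tree's `re_peterssonProduct_self_nonneg_level`). [folklore] -/
theorem peterssonLowerBound_nonnegConst_trivial : PeterssonLowerBoundNonnegConst := by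
  intro ε _
  refine ⟨0, le_rfl, fun N _ W _ f _ ↦ ?_⟩
  rw [zero_mul]
  exact re_peterssonProduct_self_nonneg_level (Gamma0 N) 2 f

/-- The crux trivially implies the `0 ≤ c` variant (sanity: the weakening is a weakening). [folklore] -/
theorem peterssonLowerBound_imp_nonnegConst :
    Summit.ABC.ABC.Theses.DefiniteXi.PeterssonLowerBound → PeterssonLowerBoundNonnegConst := by
  intro h ε hε
  obtain ⟨c, hc, h1⟩ := h ε hε
  exact ⟨c, hc.le, fun N _ W _ f hf ↦ h1 N W f hf⟩

/-! ### (b)/(c) Natural strengthenings -/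

/-- STRENGTHENING 1: exponent exactly `1` (no `ε`-loss): `∃ c > 0, c·N ≤ Re(f,f)` for every rational
newform. [folklore] -/
def PeterssonLowerBoundExponentOne : Prop :=
  ∃ c : ℝ, 0 < c ∧
    ∀ (N : ℕ) [NeZero N] (W : WeierstrassCurve ℚ) [W.IsElliptic] (f : CuspForm (Gamma0 N) 2),
      IsNewformOf W f → c * (N : ℝ) ≤ (peterssonProduct (Gamma0 N) 2 f f).re

/-- STRENGTHENING 2: the constant uniform in `ε` (quantifiers `∃ c ∀ ε` swapped). [folklore] -/
def PeterssonLowerBoundUniform : Prop :=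
  ∃ c : ℝ, 0 < c ∧ ∀ ε : ℝ, 0 < ε →
    ∀ (N : ℕ) [NeZero N] (W : WeierstrassCurve ℚ) [W.IsElliptic] (f : CuspForm (Gamma0 N) 2),
      IsNewformOf W f → c * (N : ℝ) ^ (1 - ε) ≤ (peterssonProduct (Gamma0 N) 2 f f).re

/-- Strengthening 2 implies strengthening 1 (let `ε → 0⁺`: `N^{1-ε} → N`). [folklore] -/
theorem peterssonLowerBoundUniform_imp_exponentOne :
    PeterssonLowerBoundUniform → PeterssonLowerBoundExponentOne := by
  rintro ⟨c, hc, h⟩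
  refine ⟨c, hc, fun N _ W _ f hf ↦ ?_⟩
  have hN : (0 : ℝ) < N := Nat.cast_pos.mpr (NeZero.pos N)
  -- `ε ↦ c N^{1-ε}` is continuous at `0` with value `c N`
  have hcont : Tendsto (fun ε : ℝ ↦ c * (N : ℝ) ^ (1 - ε)) (𝓝[>] 0) (𝓝 (c * N)) := by
    have h1 : Tendsto (fun ε : ℝ ↦ c * (N : ℝ) ^ (1 - ε)) (𝓝 0) (𝓝 (c * (N : ℝ) ^ (1 - (0 : ℝ)))) := by
      refine (Continuous.tendsto ?_ 0)
      exact continuous_const.mul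
        ((Real.continuous_const_rpow hN.ne').comp (continuous_const.sub continuous_id))
    rw [sub_zero, Real.rpow_one] at h1
    exact h1.mono_left nhdsWithin_le_nhds
  refine le_of_tendsto hcont ?_
  filter_upwards [self_mem_nhdsWithin] with ε hε
  exact h ε hε N W f hf

/-- Strengthening 1 implies the crux (so it is a genuine strengthening). [folklore] -/
theorem peterssonLowerBoundExponentOne_imp_crux :
    PeterssonLowerBoundExponentOne → Summit.ABC.ABC.Theses.DefiniteXi.PeterssonLowerBound := by
  rintro ⟨c, hc, h⟩ ε hε
  refine ⟨c, hc, fun N _ W _ f hf ↦ le_trans ?_ (h N W f hf)⟩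
  have hN1 : (1 : ℝ) ≤ N := by exact_mod_cast NeZero.one_le
  refine mul_le_mul_of_nonneg_left ?_ hc.le
  calc (N : ℝ) ^ (1 - ε) ≤ (N : ℝ) ^ (1 : ℝ) :=
        Real.rpow_le_rpow_of_exponent_le hN1 (by linarith)
    _ = N := Real.rpow_one _

/-- **NEAR-MISS / TIGHTNESS (paper; not closable in the tree).** Strengthening 1 is FALSE: the
`ε`-loss of the crux cannot be removed. Proof on paper. Fix any elliptic curve `E/ℚ`, newform `f`,
conductor `N`. By Rankin–Selberg (the tree's `IsNewform0.tendsto_tprod_symmSq`),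
`Re(g,g) = N_g Λ_g /(8π³ ∏_{p∥N_g}(1-p⁻²))` with `Λ_g = lim_{w→2⁺} ∏_{p∤N_g} L_p(g,w)`,
`L_p(g,w)⁻¹ = (1-α_p²p^{-w})(1-p^{1-w})(1-β_p²p^{-w})`. For a square-free `d` coprime to `2N` let
`g = f ⊗ χ_{d*}` be the newform of the quadratic twist `E^{(d*)}`, `d* = ±d ≡ 1 (4)`: level
`N_g = N d²` (additive reduction at `p ∣ d`, `p² ∥ N_g`, so `∏_{p∥N_g} = ∏_{p∥N}`), and
`a_p(g)² = a_p(f)²` for `p ∤ dN`, `a_p(g) = 0` for `p ∣ d`. Hence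
`Λ_g = Λ_f ∏_{p∣d} L_p(f,2)⁻¹ = Λ_f ∏_{p∣d} (1-1/p)(1 + (2p+1-a_p²)/p²)` and
`Re(g,g)/N_g = (Re(f,f)/N) ∏_{p∣d}(1-1/p)(1+(2p+1-a_p²)/p²)`. Take `d` = product of the primes
`p ≤ X`, `p ∤ 2N`, with `a_p(f)² ≥ 2p+1`; this set has natural density `μ_ST{|cos θ| ≥ 1/√2} =
1/2 - 1/π > 0` among primes (Sato–Tate, Barnet-Lamb–Geraghty–Harris–Taylor 2011; for CM `E` use
Hecke equidistribution, density `1/4`), so `∑_{p∣d} 1/p → ∞` and `Re(g,g)/N_g ≤ (Re(f,f)/N)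
∏_{p∣d}(1-1/p) → 0` as `X → ∞`. Thus no `c > 0` works. Quantitatively
`inf_E Re(f_E,f_E)(log log N_E)^δ/N_E < ∞` with `δ = 1/2 - 1/π`, while HL94+GHL give
`Re(f_E,f_E) ≫ N_E/((log N_E)(log log N_E)³)`: the crux's `N^{1-ε}` is safe by a wide margin and
cannot be sharpened to `N`. (Cf. Royer–Wu 2005 for extreme values of `L(1,Sym² f)` over all
newforms of prime level.) Obstruction to a Lean proof: needs twisting of newforms, the
Rankin–Selberg identity at twisted level and Sato–Tate — none in the tree. [cite: HoffsteinLockhart1994, Thm. 0.1] -/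
theorem not_peterssonLowerBoundExponentOne : ¬ PeterssonLowerBoundExponentOne := by
  sorry

/-- Consequently strengthening 2 is FALSE on paper as well (modulo the previous `sorry`). [folklore] -/
theorem not_peterssonLowerBoundUniform : ¬ PeterssonLowerBoundUniform :=
  fun h ↦ not_peterssonLowerBoundExponentOne (peterssonLowerBoundUniform_imp_exponentOne h)

/-! ### (d) Targets — line `Sketch`
No stuck stubs handed over in cycle 1; see the module docstring for the per-stub audit
(all five stubs true in print, `stub_ZE` silently leans on `differentiableOn_symmSqL_ball` and
`exists_norm_symmSqL_le`, `stub_localGHL` goes through the tree's Lemma α plus max modulus, no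
multiplicities). -/

end Summit.ABC.ABC.Cruxes.PeterssonLowerBound.Disproof

end
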